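import Literature.Computability.FineGrained.MinPlusToNegativeTriangleSweepQueries
import HarnessLib

/-!
# Distance product `≤₃` Negative Triangle: block triples, rounds, and all rounds

The search layer of the cell-sweep product step `NegTriSweep.psNT`
(`Literature.Computability.FineGrained.MinPlusToNegativeTriangleSweepProgram`; Vassilevska
Williams–Williams, J. ACM 65 (2018), proof of Thm. 4.2, pp. 27:17–18, with Lemma 4.2, p. 27:16):

* the two weight blocks of a triple (`xcopy_spec`, `ycopy_spec`) and **one block triple**
  (`triple_spec`): no pair witness left, sound marks, one query if negative and `1 + L²` queries
  with a strict increase of the marked pairs if positive;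
* **one round** (`round_spec`): all `nb³` triples by the amortised loop rule
  `ExecLE.whilenz_potential` (potential `tr (A + 2) + (n² - marks) B`: every cell sweep is paid
  by a new mark, VW–W Lemma 4.2: "the sum of all `e_{I'J'K'}` is at most `n²`"), completeness by
  `found_of_tval_lt`, then the dyadic update of the lower bounds and `pw := pw / 2`;
* **all rounds** (`rounds_spec`): the invariant `lo = ⌊tval / 2pw⌋ · 2pw` (`lo_step`) over the
  `cR c n` bits, ending with `lo = tval`.

## References

* V. Vassilevska Williams, R. R. Williams, *Subcubic equivalences between path, matrix, and
  triangle problems*, J. ACM 65 (2018), Art. 27, Thm. 4.2 (p. 27:14; proof pp. 27:17–18),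
  Lemma 4.2 (p. 27:16; proof pp. 27:16–17).
* T. Nipkow, G. Klein, *Concrete Semantics with Isabelle/HOL*, Springer 2014, §12.2.
-/

namespace Literature.Computability.FineGrained.NegTriSweep

open Cryptography Cryptography.WordRAM Cryptography.WordRAM.SProg APSPPower Matrix NegTriStep

set_option linter.unusedSimpArgs false

/-! ## Addresses of the two weight blocks -/

/-- The cells written by the `X`-block copy. [folklore] -/
theorem xcell_eq (n F r : ℕ) :
    F + 2 * (n * n) + 1 + cL n + r / cL n * (3 * cL n) + r % cL n =
      qcell n F (r / cL n) (cL n + r % cL n) := by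
  unfold qcell; ring

/-- The cells written by the `Y`-block copy. [folklore] -/
theorem ycell_eq (n F r : ℕ) :
    F + 2 * (n * n) + 1 + 3 * (cL n * cL n) + cL n + cL n + r / cL n * (3 * cL n) + r % cL n =
      qcell n F (cL n + r / cL n) (2 * cL n + r % cL n) := by
  unfold qcell; ring

/-- A query cell outside the `X` block is not written by the `X`-block copy. [folklore] -/
theorem qcell_ne_xcell {n F u v r : ℕ} (hv : v < 3 * cL n) (hr : r < cL n * cL n)
    (h : ¬ (u / cL n = 0 ∧ v / cL n = 1)) :
    qcell n F u v ≠ F + 2 * (n * n) + 1 + cL n + r / cL n * (3 * cL n) + r % cL n := by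
  rw [xcell_eq]
  unfold qcell
  intro heq
  have hL := one_le_cL n
  have h1 : r % cL n < cL n := Nat.mod_lt _ (by omega)
  have h2 : r / cL n < cL n := Nat.div_lt_of_lt_mul hr
  have heq' : u * (3 * cL n) + v = (r / cL n) * (3 * cL n) + (cL n + r % cL n) := by omega
  obtain ⟨hu, hv'⟩ := idx_inj (n := 3 * cL n) hv (by omega) heq'
  apply h
  subst hu hv'
  exact ⟨Nat.div_eq_of_lt h2, by rw [Nat.add_comm, Nat.add_div_right _ (by omega), Nat.div_eq_of_lt h1]⟩

/-- A query cell outside the `Y` block is not written by the `Y`-block copy. [folklore] -/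
theorem qcell_ne_ycell {n F u v r : ℕ} (hv : v < 3 * cL n) (hr : r < cL n * cL n)
    (h : ¬ (u / cL n = 1 ∧ v / cL n = 2)) :
    qcell n F u v ≠ F + 2 * (n * n) + 1 + 3 * (cL n * cL n) + cL n + cL n + r / cL n * (3 * cL n) + r % cL n := by
  rw [ycell_eq]
  unfold qcell
  intro heq
  have hL := one_le_cL n
  have h1 : r % cL n < cL n := Nat.mod_lt _ (by omega)
  have h2 : r / cL n < cL n := Nat.div_lt_of_lt_mul hr
  have heq' : u * (3 * cL n) + v = (cL n + r / cL n) * (3 * cL n) + (2 * cL n + r % cL n) := by omega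
  obtain ⟨hu, hv'⟩ := idx_inj (n := 3 * cL n) hv (by omega) heq'
  apply h
  subst hu hv'
  constructor
  · rw [Nat.add_comm, Nat.add_div_right _ (by omega), Nat.div_eq_of_lt h2]
  · rw [Nat.add_comm, Nat.add_mul_div_right _ _ (by omega), Nat.div_eq_of_lt h1]

/-- Marks only depend on the found stamps. [folklore] -/
theorem marks_congr {n F pw : ℕ} {H H' : ℕ → ℕ} (h : ∀ t, t < n * n → H' (F + n * n + t) = H (F + n * n + t)) :
    marks H' n F pw = marks H n F pw := by
  unfold marks
  congr 1
  exact Finset.filter_congr fun t ht => by rw [h t (Finset.mem_range.1 ht)]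

/-! ## The two weight blocks of a triple -/

/-- **The `X`-block copy**: the arcs rows → middles of the query graph of the blocks `(bi, bk)`
(codes of `QData.entryOr X M (bi L + il) (bk L + kl)`); nothing else of interest changes.
[folklore] -/
theorem xcopy_spec {w c n F pX bi bk : ℕ} {O : List ℕ → List ℕ} {X : Matrix (Fin n) (Fin n) (WithTop ℤ)}
    {H₀ S H : ℕ → ℕ} {qs : List (List ℕ)}
    (hR : Regs c n F pX S) (h60 : S 60 = cL n * cL n) (h61 : S 61 = pX + 1) (h62 : S 62 = bi * cL n)
    (h63 : S 63 = bk * cL n) (h64 : S 64 = F + 2 * (n * n) + 1 + cL n)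
    (hn : 1 ≤ n) (hpX : 100 ≤ pX) (hXF : pX + n * n < F) (hbi : bi * cL n < n) (hbk : bk * cL n < n)
    (hst : Static c n F H₀ H) (hX₀ : MatAt H₀ pX X) (hXM : HasBoundedWeights X (cM c n))
    (hcapB : 2 * (32 * cM c n + 9) < 2 ^ w) (hcapN : (n + cL n) * n + (n + cL n) < 2 ^ w)
    (hcapW : F + wspNT n < 2 ^ w) :
    ∃ S' H', ExecLE w O blockCopy ⟨merge S H, qs⟩ ⟨merge S' H', qs⟩ (cL n * cL n * 25 + 1) ∧
      (∀ i, i ≠ 60 → i ≠ 65 → i ≠ 66 → i ≠ 67 → i ≠ 68 → i ≠ 69 → i ≠ 70 → S' i = S i) ∧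
      Static c n F H₀ H' ∧
      (∀ a, a < F + 2 * (n * n) + 1 → H' a = H a) ∧
      (∀ a, F + 2 * (n * n) + (9 * (cL n * cL n) + 1) ≤ a → H' a = H a) ∧
      (∀ u v, u < 3 * cL n → v < 3 * cL n → ¬ (u / cL n = 0 ∧ v / cL n = 1) →
        H' (qcell n F u v) = H (qcell n F u v)) ∧
      (∀ il kl, il < cL n → kl < cL n → H' (qcell n F il (cL n + kl)) =
        encodeInt (QData.entryOr X (cM c n) (bi * cL n + il) (bk * cL n + kl)) + 1) := by
  have hL1 := one_le_cL n
  have hwsp : wspNT n = 2 * (n * n) + 9 * (cL n * cL n) + 3 := rfl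
  have h3LL : cL n * (3 * cL n) = 3 * (cL n * cL n) := by ring
  have hLL : cL n ≤ cL n * cL n := Nat.le_mul_self _
  have hsrcEq : ∀ t, t < n * n → H (pX + 1 + t) = H₀ (pX + 1 + t) := fun t ht => hst.below _ (by omega)
  have hsrcv : ∀ t, t < n * n → H (pX + 1 + t) ≤ 32 * cM c n + 9 := fun t ht => by
    rw [hsrcEq t ht]; exact le_trans (hX₀.apply_le hXM ht) (by omega)
  obtain ⟨S', H', hex, hS', hw, hnw⟩ := blockCopy_spec (O := O) (qs := qs) hR.r2 hR.r24 hR.r25 hR.r27 h60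
    h61 h62 h63 h64 hn hL1 rfl hbi hbk (by omega) (by omega) hsrcv hcapB hcapN (by omega)
  have hlow : ∀ a, a < F + 2 * (n * n) + 1 → H' a = H a := fun a ha =>
    hnw a fun r _ => by omega
  have hhigh : ∀ a, F + 2 * (n * n) + (9 * (cL n * cL n) + 1) ≤ a → H' a = H a := fun a ha =>
    hnw a fun r hr => by
      have := (qcell_bounds (F := F) (n := n) (u := r / cL n) (v := cL n + r % cL n)
        (by have := Nat.div_lt_of_lt_mul hr; omega) (by have := Nat.mod_lt r (show cL n > 0 by omega); omega)).2
      rw [← xcell_eq] at this; omega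
  have hcell : ∀ u v, u < 3 * cL n → v < 3 * cL n → ¬ (u / cL n = 0 ∧ v / cL n = 1) →
      H' (qcell n F u v) = H (qcell n F u v) := fun u v hu hv huv => hnw _ fun r hr => qcell_ne_xcell hv hr huv
  refine ⟨S', H', hex, hS', ?_, hlow, hhigh, hcell, fun il kl hil hkl => ?_⟩
  · exact
      { below := fun a ha => by rw [hlow a (by omega)]; exact hst.below a ha
        hdr := by rw [hlow _ (by omega)]; exact hst.hdr
        bg := fun u v hu hv h1 h2 h3 => by rw [hcell u v hu hv h1]; exact hst.bg u v hu hv h1 h2 h3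
        above := fun a ha => by rw [hhigh a (by omega)]; exact hst.above a ha
        fd_le := fun t ht => by rw [hlow _ (by omega)]; exact hst.fd_le t ht }
  · have hr : il * cL n + kl < cL n * cL n := NegTriToAPSP.mul_add_lt_mul hil hkl
    have := hw _ hr
    rw [xcell_eq, NegTriToAPSP.div_of_mul_add hkl, Nat.mul_add_mod_of_lt hkl] at this
    rw [this, bcVal_congr (H := H₀) hsrcEq]
    exact bcVal_eq_entryOr hX₀

/-- **The `Y`-block copy**: the arcs middles → columns of the query graph of the blocks
`(bk, bj)`. [folklore] -/
theorem ycopy_spec {w c n F pX bj bk : ℕ} {O : List ℕ → List ℕ} {Y : Matrix (Fin n) (Fin n) (WithTop ℤ)}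
    {H₀ S H : ℕ → ℕ} {qs : List (List ℕ)}
    (hR : Regs c n F pX S) (h60 : S 60 = cL n * cL n) (h61 : S 61 = pX + n * n + 1 + 1)
    (h62 : S 62 = bk * cL n) (h63 : S 63 = bj * cL n)
    (h64 : S 64 = F + 2 * (n * n) + 1 + 3 * (cL n * cL n) + cL n + cL n)
    (hn : 1 ≤ n) (hpX : 100 ≤ pX) (hYF : pX + n * n + 1 + n * n < F) (hbj : bj * cL n < n)
    (hbk : bk * cL n < n)
    (hst : Static c n F H₀ H) (hY₀ : MatAt H₀ (pX + n * n + 1) Y) (hYM : HasBoundedWeights Y (cM c n))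
    (hcapB : 2 * (32 * cM c n + 9) < 2 ^ w) (hcapN : (n + cL n) * n + (n + cL n) < 2 ^ w)
    (hcapW : F + wspNT n < 2 ^ w) :
    ∃ S' H', ExecLE w O blockCopy ⟨merge S H, qs⟩ ⟨merge S' H', qs⟩ (cL n * cL n * 25 + 1) ∧
      (∀ i, i ≠ 60 → i ≠ 65 → i ≠ 66 → i ≠ 67 → i ≠ 68 → i ≠ 69 → i ≠ 70 → S' i = S i) ∧
      Static c n F H₀ H' ∧
      (∀ a, a < F + 2 * (n * n) + 1 → H' a = H a) ∧
      (∀ a, F + 2 * (n * n) + (9 * (cL n * cL n) + 1) ≤ a → H' a = H a) ∧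
      (∀ u v, u < 3 * cL n → v < 3 * cL n → ¬ (u / cL n = 1 ∧ v / cL n = 2) →
        H' (qcell n F u v) = H (qcell n F u v)) ∧
      (∀ kl jl, kl < cL n → jl < cL n → H' (qcell n F (cL n + kl) (2 * cL n + jl)) =
        encodeInt (QData.entryOr Y (cM c n) (bk * cL n + kl) (bj * cL n + jl)) + 1) := by
  have hL1 := one_le_cL n
  have hwsp : wspNT n = 2 * (n * n) + 9 * (cL n * cL n) + 3 := rfl
  have h3LL : cL n * (3 * cL n) = 3 * (cL n * cL n) := by ring
  have hLL : cL n ≤ cL n * cL n := Nat.le_mul_self _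
  have hsrcEq : ∀ t, t < n * n → H (pX + n * n + 1 + 1 + t) = H₀ (pX + n * n + 1 + 1 + t) := fun t ht =>
    hst.below _ (by omega)
  have hsrcv : ∀ t, t < n * n → H (pX + n * n + 1 + 1 + t) ≤ 32 * cM c n + 9 := fun t ht => by
    rw [hsrcEq t ht]; exact le_trans (hY₀.apply_le hYM ht) (by omega)
  obtain ⟨S', H', hex, hS', hw, hnw⟩ := blockCopy_spec (O := O) (qs := qs) hR.r2 hR.r24 hR.r25 hR.r27 h60
    h61 h62 h63 h64 hn hL1 rfl hbk hbj (by omega) (by omega) hsrcv hcapB hcapN (by omega)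
  have hlow : ∀ a, a < F + 2 * (n * n) + 1 → H' a = H a := fun a ha =>
    hnw a fun r _ => by omega
  have hhigh : ∀ a, F + 2 * (n * n) + (9 * (cL n * cL n) + 1) ≤ a → H' a = H a := fun a ha =>
    hnw a fun r hr => by
      have := (qcell_bounds (F := F) (n := n) (u := cL n + r / cL n) (v := 2 * cL n + r % cL n)
        (by have := Nat.div_lt_of_lt_mul hr; omega) (by have := Nat.mod_lt r (show cL n > 0 by omega); omega)).2
      rw [← ycell_eq] at this; omega
  have hcell : ∀ u v, u < 3 * cL n → v < 3 * cL n → ¬ (u / cL n = 1 ∧ v / cL n = 2) →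
      H' (qcell n F u v) = H (qcell n F u v) := fun u v hu hv huv => hnw _ fun r hr => qcell_ne_ycell hv hr huv
  refine ⟨S', H', hex, hS', ?_, hlow, hhigh, hcell, fun kl jl hkl hjl => ?_⟩
  · exact
      { below := fun a ha => by rw [hlow a (by omega)]; exact hst.below a ha
        hdr := by rw [hlow _ (by omega)]; exact hst.hdr
        bg := fun u v hu hv h1 h2 h3 => by rw [hcell u v hu hv h2]; exact hst.bg u v hu hv h1 h2 h3
        above := fun a ha => by rw [hhigh a (by omega)]; exact hst.above a ha
        fd_le := fun t ht => by rw [hlow _ (by omega)]; exact hst.fd_le t ht }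
  · have hr : kl * cL n + jl < cL n * cL n := NegTriToAPSP.mul_add_lt_mul hkl hjl
    have := hw _ hr
    rw [ycell_eq, NegTriToAPSP.div_of_mul_add hjl, Nat.mul_add_mod_of_lt hjl] at this
    rw [this, bcVal_congr (H := H₀) hsrcEq]
    exact bcVal_eq_entryOr hY₀

end Literature.Computability.FineGrained.NegTriSweep

namespace Literature.Computability.FineGrained.NegTriSweep

open Cryptography Cryptography.WordRAM Cryptography.WordRAM.SProg APSPPower Matrix NegTriStep

set_option linter.unusedSimpArgs false

/-! ## One block triple -/

open Classical in
/-- **One block triple** (`tripleBody`; VW–W Lemma 4.2, the processing of one triple of parts):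
afterwards the triple `(bi, bj, bk)` of index `t = r41 - 1` has no pair witness, the marks made
are sound, and either one query was made (negative triple) or `1 + L²` queries were made and the
number of marked pairs went up (positive triple) — with the corresponding time bounds. [folklore] -/
theorem triple_spec {w c n F pX pw tr : ℕ} {O : List ℕ → List ℕ}
    {X Y : Matrix (Fin n) (Fin n) (WithTop ℤ)} {H₀ S H : ℕ → ℕ} {qs : List (List ℕ)}
    (hR : Regs c n F pX S) (h40 : S 40 = pw) (h41 : S 41 = tr + 1) (htr : tr < cNB n * cNB n * cNB n)
    (hn : 1 ≤ n) (hF : 100 ≤ F) (hpX : 100 ≤ pX) (hYF : pX + n * n + 1 + n * n < F)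
    (hst : Static c n F H₀ H) (hX₀ : MatAt H₀ pX X) (hY₀ : MatAt H₀ (pX + n * n + 1) Y)
    (hXM : HasBoundedWeights X (cM c n)) (hYM : HasBoundedWeights Y (cM c n))
    (hpw1 : 1 ≤ pw) (hpw4 : pw ≤ 4 * cM c n)
    (hlo : ∀ t, t < n * n → H (F + t) + pw < 8 * cM c n)
    (hsound : ∀ i j : Fin n, H (F + n * n + (i * n + j)) = pw →
      tval X Y (cM c n) (8 * cM c n) i j < H (F + (i * n + j)) + pw)
    (hO : (NegativeTriangle (6 * c + 11)).OracleAnswers O)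
    (hcapB : 2 * (32 * cM c n + 9) < 2 ^ w) (hcapN : (n + cL n) * n + (n + cL n) < 2 ^ w)
    (hcapW : F + wspNT n < 2 ^ w) (hcapNB : cNB n * cNB n * cNB n < 2 ^ w) :
    ∃ (S' H' : ℕ → ℕ) (bs : List (NegativeTriangle (6 * c + 11)).Inst) (t : ℕ),
      Exec w O tripleBody ⟨merge S H, qs⟩
        ⟨merge S' H', qs ++ bs.map (NegativeTriangle (6 * c + 11)).encode⟩ t ∧
      (∀ i, i < 41 ∨ 70 < i → S' i = S i) ∧ S' 41 = tr ∧
      Static c n F H₀ H' ∧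
      (∀ t', t' < n * n → H' (F + t') = H (F + t')) ∧
      (∀ t', t' < n * n → H' (F + n * n + t') = H (F + n * n + t') ∨ H' (F + n * n + t') = pw) ∧
      (∀ i j : Fin n, H' (F + n * n + (i * n + j)) = pw →
        tval X Y (cM c n) (8 * cM c n) i j < H' (F + (i * n + j)) + pw) ∧
      (∀ iu iv, iu < cL n → iv < cL n →
        ¬ (qd X Y H' c F pw (tr / (cNB n * cNB n)) (tr / cNB n % cNB n) (tr % cNB n)).PairWit iu iv) ∧
      ((t ≤ 96 * (cL n * cL n) + 25 ∧ bs.length = 1) ∨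
        (t ≤ 96 * (cL n * cL n) + 25 + (cL n * cL n * (cL n * cL n * 46 + 20) + 3) ∧
          bs.length = 1 + cL n * cL n ∧ marks H n F pw < marks H' n F pw)) ∧
      (∀ y ∈ bs, (NegativeTriangle (6 * c + 11)).size y = 3 * cL n) ∧
      (∀ y ∈ bs, ((NegativeTriangle (6 * c + 11)).encode y).length = 9 * (cL n * cL n) + 1) := by
  have hL1 := one_le_cL n
  have hLL : cL n ≤ cL n * cL n := Nat.le_mul_self _
  have hwsp : wspNT n = 2 * (n * n) + 9 * (cL n * cL n) + 3 := rfl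
  have h3LL : cL n * (3 * cL n) = 3 * (cL n * cL n) := by ring
  have hM1 := one_le_cM c n
  have hpw2 : pw < 2 ^ w := by omega
  have hNB1 := one_le_cNB hn
  have hXF : pX + n * n < F := by omega
  -- the indices of the triple
  have hbiN : tr / (cNB n * cNB n) < cNB n := Nat.div_lt_of_lt_mul htr
  have hbjN : tr / cNB n % cNB n < cNB n := Nat.mod_lt _ hNB1
  have hbkN : tr % cNB n < cNB n := Nat.mod_lt _ hNB1
  -- 1. registers of the triple and of the `X` copy
  obtain ⟨st₁, hex₁, S₁, rfl, hS₁, h41₁, h42₁, h43₁, h44₁, h60₁, h61₁, h62₁, h63₁, h64₁⟩ :=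
    tripleOps1_spec (O := O) (H := H) (qs := qs) hR h41 hn htr hcapNB hcapW hXF
  generalize hbi : tr / (cNB n * cNB n) = bi at *
  generalize hbj : tr / cNB n % cNB n = bj at *
  generalize hbk : tr % cNB n = bk at *
  have hbiL : bi * cL n < n := block_mul_lt hn hbiN
  have hbjL : bj * cL n < n := block_mul_lt hn hbjN
  have hbkL : bk * cL n < n := block_mul_lt hn hbkN
  have hR₁ : Regs c n F pX S₁ := hR.of_agree fun i hi => hS₁ i (Or.inl (by omega))
  -- 2. the `X` block
  obtain ⟨S₂, H₂, hex₂, hS₂, hst₂, hlow₂, hhigh₂, hcell₂, hXb₂⟩ := xcopy_spec (O := O) (qs := qs) hR₁ h60₁ h61₁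
    h62₁ h63₁ h64₁ hn hpX hXF hbiL hbkL hst hX₀ hXM hcapB hcapN hcapW
  have e2 : ∀ i, i < 60 ∨ 70 < i → S₂ i = S₁ i := fun i hi =>
    hS₂ i (by omega) (by omega) (by omega) (by omega) (by omega) (by omega) (by omega)
  have hR₂ : Regs c n F pX S₂ := hR₁.of_agree fun i hi => e2 i (Or.inl (by omega))
  -- 3. registers of the `Y` copy
  obtain ⟨st₃, hex₃, S₃, rfl, hS₃, h60₃, h61₃, h62₃, h63₃, h64₃⟩ :=
    tripleOps2_spec (O := O) (H := H₂) (qs := qs) hR₂ ((e2 43 (by omega)).trans h43₁)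
      ((e2 44 (by omega)).trans h44₁) hbjL hbkL hcapW hXF
  have hR₃ : Regs c n F pX S₃ := hR₂.of_agree fun i hi => hS₃ i (Or.inl (by omega))
  -- 4. the `Y` block
  obtain ⟨S₄, H₄, hex₄, hS₄, hst₄, hlow₄, hhigh₄, hcell₄, hYb₄⟩ := ycopy_spec (O := O) (qs := qs) hR₃ h60₃ h61₃
    h62₃ h63₃ h64₃ hn hpX hYF hbjL hbkL hst₂ hY₀ hYM hcapB hcapN hcapW
  have e4 : ∀ i, i < 60 ∨ 70 < i → S₄ i = S₃ i := fun i hi =>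
    hS₄ i (by omega) (by omega) (by omega) (by omega) (by omega) (by omega) (by omega)
  have hR₄ : Regs c n F pX S₄ := hR₃.of_agree fun i hi => e4 i (Or.inl (by omega))
  have hXb₄ : ∀ il kl, il < cL n → kl < cL n → H₄ (qcell n F il (cL n + kl)) =
      encodeInt (QData.entryOr X (cM c n) (bi * cL n + il) (bk * cL n + kl)) + 1 := fun il kl hil hkl => by
    rw [hcell₄ _ _ (by omega) (by omega) (by
      rintro ⟨h, -⟩; rw [Nat.div_eq_of_lt hil] at h; exact absurd h (by norm_num))]
    exact hXb₂ il kl hil hkl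
  -- 5. the full window
  obtain ⟨st₅, hex₅, S₅, rfl, hS₅, h46₅, h47₅, h48₅, h49₅, h50₅⟩ :=
    tripleOps3_spec (O := O) (H := H₄) (qs := qs) hR₄ hcapW
  have hR₅ : Regs c n F pX S₅ := hR₄.of_agree fun i hi => hS₅ i (Or.inl (by omega))
  -- registers so far
  have e5 : ∀ i, i < 41 ∨ 70 < i → S₅ i = S i := fun i hi => by
    rw [hS₅ i (by omega), e4 i (by omega), hS₃ i (by omega), e2 i (by omega), hS₁ i (by omega)]
  have h40₅ : S₅ 40 = pw := (e5 40 (by omega)).trans h40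
  have h41₅ : S₅ 41 = tr := by rw [hS₅ 41 (by omega), e4 41 (by omega), hS₃ 41 (by omega), e2 41 (by omega), h41₁]
  have h42₅ : S₅ 42 = bi := by rw [hS₅ 42 (by omega), e4 42 (by omega), hS₃ 42 (by omega), e2 42 (by omega), h42₁]
  have h43₅ : S₅ 43 = bj := by rw [hS₅ 43 (by omega), e4 43 (by omega), hS₃ 43 (by omega), e2 43 (by omega), h43₁]
  -- the data so far: `lo`, `fd` untouched
  have hlow₄' : ∀ a, a < F + 2 * (n * n) + 1 → H₄ a = H a := fun a ha => (hlow₄ a ha).trans (hlow₂ a ha)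
  -- 6. the back arcs for the full window
  obtain ⟨S₆, H₆, hex₆, hS₆, hT, hnT⟩ := buildT_spec (O := O) (S := S₅) (H := H₄) (qs := qs)
    hR₅.r2 hR₅.r9 hR₅.r19 hR₅.r22 hR₅.r24 hR₅.r25 hR₅.r27 hR₅.r30 hR₅.r38 h40₅ h42₅ h43₅
    h46₅ h47₅ h48₅ h49₅ h50₅ hn hL1 rfl hbiL hbjL (by norm_num) (by norm_num) hF rfl (by omega) (by omega) hpw1
    (fun t ht => by rw [hlow₄' _ (by omega)]; have := hlo t ht; omega)
    (fun t ht => by rw [hlow₄' _ (by omega)]; have := hst.fd_le t ht; omega) hcapB hcapN (by omega)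
  have hR₆ : Regs c n F pX S₆ := hR₅.of_agree fun i hi => hS₆ i (Or.inl (by omega))
  have hlow₆ : ∀ a, a < F + 2 * (n * n) + 1 → H₆ a = H₄ a := fun a ha =>
    hnT a fun r hr => by have := (tcell_bounds (F := F) (n := n) hr).1; omega
  have hhigh₆ : ∀ a, F + 2 * (n * n) + (9 * (cL n * cL n) + 1) ≤ a → H₆ a = H₄ a := fun a ha =>
    hnT a fun r hr => by have := (tcell_bounds (F := F) (n := n) hr).2; omega
  have hcell₆ : ∀ u v, u < 3 * cL n → v < 3 * cL n → ¬ (u / cL n = 2 ∧ v / cL n = 0) →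
      H₆ (qcell n F u v) = H₄ (qcell n F u v) := fun u v hu hv huv =>
    hnT _ fun r hr => qcell_ne_tcell hv hr huv
  -- 7. the query
  set q₄ := qd X Y H₄ c F pw bi bj bk with hq₄
  set qf := q₄.setWin (winLo 0 0) (winHi 0 0 (cL n)) (winLo 0 0) (winHi 0 0 (cL n)) with hqf
  have hcodes : ∀ u v, u < 3 * cL n → v < 3 * cL n → H₆ (qcell n F u v) = encodeInt (qf.qmatN u v) + 1 := by
    refine query_cells (c := c) qf rfl rfl (fun u v hu hv h1 h2 h3 => ?_) (fun il kl hil hkl => ?_)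
      (fun kl jl hkl hjl => ?_) (fun iu iv hiu' hiv' => ?_)
    · rw [hcell₆ u v hu hv h3]; exact hst₄.bg u v hu hv h1 h2 h3
    · rw [hcell₆ _ _ (by omega) (by omega) (by
        rintro ⟨h, -⟩; rw [Nat.div_eq_of_lt hil] at h; exact absurd h (by norm_num))]
      exact hXb₄ il kl hil hkl
    · rw [hcell₆ _ _ (by omega) (by omega) (by
        rintro ⟨h, -⟩
        rw [Nat.add_comm, Nat.add_div_right _ (by omega), Nat.div_eq_of_lt hkl] at h
        exact absurd h (by norm_num))]
      exact hYb₄ kl jl hkl hjl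
    · have hr : iu * cL n + iv < cL n * cL n := NegTriToAPSP.mul_add_lt_mul hiu' hiv'
      have hdiv : (iu * cL n + iv) / cL n = iu := NegTriToAPSP.div_of_mul_add hiv'
      have hmod : (iu * cL n + iv) % cL n = iv := Nat.mul_add_mod_of_lt hiv'
      have := hT _ hr
      rw [tcell_eq, hdiv, hmod] at this
      rw [this, tbVal_eq_tarc (X := X) (Y := Y) (bk := bk) (Or.inl ⟨rfl, rfl⟩) (Or.inl ⟨rfl, rfl⟩) hiu' hiv']
  have hhdr₆ : H₆ (F + 2 * (n * n)) = 3 * cL n := by rw [hlow₆ _ (by omega)]; exact hst₄.hdr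
  have hseg := readSeg_query qf rfl hhdr₆ hcodes
  have hlo_qf : ∀ t, t < n * n → qf.lo t + qf.pw ≤ 8 * qf.M + 2 := fun t ht => by
    show H₄ (F + t) + pw ≤ 8 * cM c n + 2; rw [hlow₄' _ (by omega)]; have := hlo t ht; omega
  obtain ⟨y, hency, hsize, hans⟩ := oracle_answer hO hn qf rfl rfl hXM hYM hlo_qf
  have hwit : qf.Witness ↔ ∃ iu iv, iu < cL n ∧ iv < cL n ∧ q₄.PairWit iu iv := by
    have := QData.witness_full_iff q₄
    simp only [hqf, winLo, winHi, if_true]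
    exact this
  have hq₄H : ∀ iu iv, q₄.PairWit iu iv ↔ (qd X Y H c F pw bi bj bk).PairWit iu iv := fun iu iv =>
    pairWit_congr (fun t ht => hlow₄' _ (by omega)) (fun t ht => hlow₄' _ (by omega)) iu iv
  -- 8. ask
  have hexA := ask_exec (w := w) (O := O) (S := S₆) (H := H₆) (qs := qs) hR₆ hF
  rw [hseg, hans] at hexA
  set b : ℕ := if qf.Witness then 1 else 0 with hb
  have hb1 : b ≤ 1 := by rw [hb]; exact NegTriToAPSP.ite_le_one _
  have hbmod : [b].map (· % 2 ^ w) = [b] := by simp [Nat.mod_eq_of_lt (show b < 2 ^ w by omega)]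
  rw [hbmod] at hexA
  set AB := F + 2 * (n * n) + (9 * (cL n * cL n) + 1) with hAB
  obtain ⟨hA0, hA1, hAx⟩ := segWrite_single H₆ AB b
  set H₇ := segWrite H₆ AB [b] with hH₇
  have hread : (Operand.ind 36).read (merge S₆ H₇) = b := by
    rw [Operand.read_ind_merge (by norm_num) (by rw [hR₆.r36]; omega), hR₆.r36]; exact hA1
  have hlow₇ : ∀ a, a < F + 2 * (n * n) + 1 → H₇ a = H a := fun a ha => by
    rw [hAx a (by omega) (by omega), hlow₆ a ha]; exact hlow₄' a ha
  have hhigh₇ : ∀ a, F + wspNT n ≤ a → H₇ a = H a := fun a ha => by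
    rw [hAx a (by omega) (by omega), hhigh₆ a (by omega), hhigh₄ a (by omega)]; exact hhigh₂ a (by omega)
  have hcell₇ : ∀ u v, u < 3 * cL n → v < 3 * cL n → ¬ (u / cL n = 2 ∧ v / cL n = 0) →
      H₇ (qcell n F u v) = H₄ (qcell n F u v) := fun u v hu hv huv => by
    have := qcell_bounds (F := F) (n := n) hu hv
    rw [hAx _ (by omega) (by omega)]; exact hcell₆ u v hu hv huv
  have hst₇ : Static c n F H₀ H₇ :=
    { below := fun a ha => by rw [hlow₇ a (by omega)]; exact hst.below a ha
      hdr := by rw [hlow₇ _ (by omega)]; exact hst.hdr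
      bg := fun u v hu hv h1 h2 h3 => by rw [hcell₇ u v hu hv h3]; exact hst₄.bg u v hu hv h1 h2 h3
      above := fun a ha => by rw [hhigh₇ a ha]; exact hst.above a ha
      fd_le := fun t ht => by rw [hlow₇ _ (by omega)]; exact hst.fd_le t ht }
  have e6 : ∀ i, i < 41 ∨ 70 < i → S₆ i = S i := fun i hi => (hS₆ i (by omega)).trans (e5 i hi)
  have hel : ((NegativeTriangle (6 * c + 11)).encode y).length = 9 * (cL n * cL n) + 1 := by
    rw [hency, encodeMatrixWithTop_length]; show (3 * cL n) ^ 2 + 1 = _; ring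
  -- the execution up to the query
  obtain ⟨t₂, ht₂, hex₂'⟩ := hex₂
  obtain ⟨t₄, ht₄, hex₄'⟩ := hex₄
  obtain ⟨t₆, ht₆, hex₆'⟩ := hex₆
  -- 9. the test
  by_cases hp : ∃ iu iv, iu < cL n ∧ iv < cL n ∧ (qd X Y H c F pw bi bj bk).PairWit iu iv
  · -- a positive triple: sweep the cells
    have hp₄ : ∃ iu iv, iu < cL n ∧ iv < cL n ∧ q₄.PairWit iu iv := by
      obtain ⟨iu, iv, hiu, hiv, h⟩ := hp; exact ⟨iu, iv, hiu, hiv, (hq₄H iu iv).2 h⟩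
    have hb' : b = 1 := by rw [hb, if_pos (hwit.2 hp₄)]
    obtain ⟨S₈, H₈, bs₈, hexC, hS₈, hst₈, hcell₈, hlo₈, hmono₈, hsound₈, hnowit₈, hprog₈, hlen₈, hsz₈, hel₈⟩ :=
      cells_spec (O := O) (qs := qs ++ [(NegativeTriangle (6 * c + 11)).encode y]) (X := X) (Y := Y) (bk := bk)
        hR₆ ((e6 40 (by omega)).trans h40) ((hS₆ 42 (by omega)).trans h42₅) ((hS₆ 43 (by omega)).trans h43₅)
        hn hF hbiN hbjN hst₇
        (fun il kl hil hkl => by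
          rw [hcell₇ _ _ (by omega) (by omega) (by
            rintro ⟨h, -⟩; rw [Nat.div_eq_of_lt hil] at h; exact absurd h (by norm_num))]
          exact hXb₄ il kl hil hkl)
        (fun kl jl hkl hjl => by
          rw [hcell₇ _ _ (by omega) (by omega) (by
            rintro ⟨h, -⟩
            rw [Nat.add_comm, Nat.add_div_right _ (by omega), Nat.div_eq_of_lt hkl] at h
            exact absurd h (by norm_num))]
          exact hYb₄ kl jl hkl hjl)
        hXM hYM hpw1 hpw4 (fun t ht => by rw [hlow₇ _ (by omega)]; exact hlo t ht)
        (fun i j hf => by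
          have ht : (i : ℕ) * n + j < n * n := NegTriToAPSP.mul_add_lt_mul i.isLt j.isLt
          rw [hlow₇ _ (by omega)] at hf ⊢; exact hsound i j hf)
        hO hcapB hcapN hcapW
    obtain ⟨tC, htC, hexC'⟩ := hexC
    have hif : Exec w O (ifz (.ind 36) skip cells) ⟨merge S₆ H₇, qs ++ [(NegativeTriangle (6 * c + 11)).encode y]⟩
        ⟨merge S₈ H₈, qs ++ [(NegativeTriangle (6 * c + 11)).encode y] ++
          bs₈.map (NegativeTriangle (6 * c + 11)).encode⟩ (tC + 2) :=
      Exec.ifz_ne (by rw [hread, hb']; norm_num) hexC'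
    have hexAll := hex₁.seqs_cons (hex₂'.seqs_cons (hex₃.seqs_cons (hex₄'.seqs_cons (hex₅.seqs_cons
      (hex₆'.seqs_cons ((hency ▸ hexA).seqs_cons (Exec.seqs_one hif)))))))
    have hH₇H : ∀ t, t < n * n → H₇ (F + n * n + t) = H (F + n * n + t) := fun t ht => hlow₇ _ (by omega)
    have hexAll' : Exec w O tripleBody ⟨merge S H, qs⟩
        ⟨merge S₈ H₈, qs ++ (y :: bs₈).map (NegativeTriangle (6 * c + 11)).encode⟩
        (10 + (t₂ + (5 + (t₄ + (5 + (t₆ + (1 + (tC + 2)))))))) := by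
      unfold tripleBody
      simpa [List.map_cons, List.append_assoc] using hexAll
    refine ⟨S₈, H₈, y :: bs₈, _, hexAll', fun i hi => (hS₈ i (by omega)).trans (e6 i hi),
      by rw [hS₈ 41 (by omega), hS₆ 41 (by omega), h41₅], hst₈,
      fun t ht => (hlo₈ t ht).trans (hlow₇ _ (by omega)), fun t ht => ?_, hsound₈, hnowit₈,
      Or.inr ⟨by omega, by simp [hlen₈]; ring, ?_⟩, ?_, ?_⟩
    · rcases hmono₈ t ht with h | h
      · exact Or.inl (h.trans (hH₇H t ht))
      · exact Or.inr h
    · rw [← marks_congr (H := H) (H' := H₇) hH₇H]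
      obtain ⟨iu, iv, hiu, hiv, h⟩ := hp
      exact hprog₈ ⟨iu, iv, hiu, hiv, (pairWit_congr (fun t ht => hlow₇ _ (by omega))
        (fun t ht => hlow₇ _ (by omega)) iu iv).2 h⟩
    · intro y' hy'
      rcases List.mem_cons.1 hy' with rfl | h
      · exact hsize
      · exact hsz₈ y' h
    · intro y' hy'
      rcases List.mem_cons.1 hy' with rfl | h
      · exact hel
      · exact hel₈ y' h
  · -- a negative triple
    have hb' : b = 0 := by
      rw [hb, if_neg]
      intro hw
      obtain ⟨iu, iv, hiu, hiv, h⟩ := hwit.1 hw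
      exact hp ⟨iu, iv, hiu, hiv, (hq₄H iu iv).1 h⟩
    have hif : Exec w O (ifz (.ind 36) skip cells) ⟨merge S₆ H₇, qs ++ [(NegativeTriangle (6 * c + 11)).encode y]⟩
        ⟨merge S₆ H₇, qs ++ [(NegativeTriangle (6 * c + 11)).encode y]⟩ (0 + 1) :=
      Exec.ifz_zero (by rw [hread, hb']) (Exec.skip _)
    have hexAll := hex₁.seqs_cons (hex₂'.seqs_cons (hex₃.seqs_cons (hex₄'.seqs_cons (hex₅.seqs_cons
      (hex₆'.seqs_cons ((hency ▸ hexA).seqs_cons (Exec.seqs_one hif)))))))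
    have hexAll' : Exec w O tripleBody ⟨merge S H, qs⟩
        ⟨merge S₆ H₇, qs ++ [y].map (NegativeTriangle (6 * c + 11)).encode⟩
        (10 + (t₂ + (5 + (t₄ + (5 + (t₆ + (1 + (0 + 1)))))))) := by
      unfold tripleBody
      simpa using hexAll
    refine ⟨S₆, H₇, [y], _, hexAll', e6, (hS₆ 41 (by omega)).trans h41₅, hst₇,
      fun t ht => hlow₇ _ (by omega), fun t ht => Or.inl (hlow₇ _ (by omega)), fun i j hf => ?_,
      fun iu iv hiu hiv h => hp ⟨iu, iv, hiu, hiv, ?_⟩, Or.inl ⟨by omega, rfl⟩,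
      fun y' hy' => by rw [List.mem_singleton.1 hy']; exact hsize,
      fun y' hy' => by rw [List.mem_singleton.1 hy']; exact hel⟩
    · have ht : (i : ℕ) * n + j < n * n := NegTriToAPSP.mul_add_lt_mul i.isLt j.isLt
      rw [hlow₇ _ (by omega)] at hf ⊢; exact hsound i j hf
    · exact (pairWit_congr (fun t ht => hlow₇ _ (by omega)) (fun t ht => hlow₇ _ (by omega)) iu iv).1 h

end Literature.Computability.FineGrained.NegTriSweep

namespace Literature.Computability.FineGrained.NegTriSweep

open Cryptography Cryptography.WordRAM Cryptography.WordRAM.SProg APSPPower Matrix NegTriStep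

set_option linter.unusedSimpArgs false

/-! ## One round of the search -/

/-- Every block triple is the triple of some index below `nb³`. [folklore] -/
theorem triple_decode {nb bi bj bk : ℕ} (hbi : bi < nb) (hbj : bj < nb) (hbk : bk < nb) :
    bi * (nb * nb) + bj * nb + bk < nb * nb * nb ∧
      (bi * (nb * nb) + bj * nb + bk) / (nb * nb) = bi ∧
      (bi * (nb * nb) + bj * nb + bk) / nb % nb = bj ∧ (bi * (nb * nb) + bj * nb + bk) % nb = bk := by
  have hnb : 0 < nb := by omega
  have h1 : bj * nb + bk < nb * nb := NegTriToAPSP.mul_add_lt_mul hbj hbk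
  refine ⟨?_, ?_, ?_, ?_⟩
  · calc bi * (nb * nb) + bj * nb + bk = bi * (nb * nb) + (bj * nb + bk) := by ring
      _ < bi * (nb * nb) + nb * nb := by omega
      _ = (bi + 1) * (nb * nb) := by ring
      _ ≤ nb * (nb * nb) := Nat.mul_le_mul_right _ hbi
      _ = nb * nb * nb := by ring
  · rw [show bi * (nb * nb) + bj * nb + bk = bi * (nb * nb) + (bj * nb + bk) by ring]
    exact NegTriToAPSP.div_of_mul_add h1
  · rw [show bi * (nb * nb) + bj * nb + bk = bk + nb * (bj + bi * nb) by ring,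
      Nat.add_mul_div_left _ _ hnb, Nat.div_eq_of_lt hbk, Nat.zero_add, Nat.add_mul_mod_self_right,
      Nat.mod_eq_of_lt hbj]
  · rw [show bi * (nb * nb) + bj * nb + bk = bk + (bj + bi * nb) * nb by ring, Nat.add_mul_mod_self_right,
      Nat.mod_eq_of_lt hbk]

/-- The potential pays for the cell sweep of a positive triple. [folklore] -/
theorem potential_step {tr A Bc N m m'' t : ℕ} (hm : m'' ≤ N)
    (h : t ≤ A ∧ m ≤ m'' ∨ t ≤ A + Bc ∧ m + 1 ≤ m'') :
    t + 2 + (tr * (A + 2) + (N - m'') * Bc) ≤ (tr + 1) * (A + 2) + (N - m) * Bc := by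
  rcases h with ⟨ht, hmm⟩ | ⟨ht, hmm⟩
  · have : (N - m'') * Bc ≤ (N - m) * Bc := Nat.mul_le_mul_right _ (by omega)
    nlinarith
  · have : (N - m'') * Bc + Bc ≤ (N - m) * Bc := by
      rw [← Nat.succ_mul]; exact Nat.mul_le_mul_right _ (by omega)
    nlinarith

open Classical in
/-- **One round of the simultaneous binary search** (`roundBody`: all `nb³` block triples, then
the dyadic update of the lower bounds, then `pw := pw / 2`; VW–W proof of Thm. 4.2, one iteration,
with Lemma 4.2 for the list of `IJ`-disjoint negative triangles). Started with lower bounds `lo`,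
no pair marked at `pw`, it ends with `lo[i, j]` increased by `pw` exactly for the pairs whose
searched value is not below `lo[i, j] + pw`, found stamps only raised to `pw`, at most
`nb³ + L² n²` queries of size `3L`, within the stated time. [folklore] -/
theorem round_spec {w c n F pX pw : ℕ} {O : List ℕ → List ℕ}
    {X Y : Matrix (Fin n) (Fin n) (WithTop ℤ)} {H₀ S H : ℕ → ℕ} {qs : List (List ℕ)}
    (hR : Regs c n F pX S) (h40 : S 40 = pw)
    (hn : 1 ≤ n) (hF : 100 ≤ F) (hpX : 100 ≤ pX) (hYF : pX + n * n + 1 + n * n < F)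
    (hst : Static c n F H₀ H) (hX₀ : MatAt H₀ pX X) (hY₀ : MatAt H₀ (pX + n * n + 1) Y)
    (hXM : HasBoundedWeights X (cM c n)) (hYM : HasBoundedWeights Y (cM c n))
    (hpw1 : 1 ≤ pw) (hpw4 : pw ≤ 4 * cM c n)
    (hlo : ∀ t, t < n * n → H (F + t) + pw < 8 * cM c n)
    (hfd : ∀ t, t < n * n → H (F + n * n + t) ≠ pw)
    (hO : (NegativeTriangle (6 * c + 11)).OracleAnswers O)
    (hcapB : 2 * (32 * cM c n + 9) < 2 ^ w) (hcapN : (n + cL n) * n + (n + cL n) < 2 ^ w)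
    (hcapW : F + wspNT n < 2 ^ w) (hcapNB : cNB n * cNB n * cNB n < 2 ^ w) :
    ∃ (S' H' : ℕ → ℕ) (bs : List (NegativeTriangle (6 * c + 11)).Inst),
      ExecLE w O roundBody ⟨merge S H, qs⟩
        ⟨merge S' H', qs ++ bs.map (NegativeTriangle (6 * c + 11)).encode⟩
        (cNB n * cNB n * cNB n * (96 * (cL n * cL n) + 27) +
          n * n * (cL n * cL n * (cL n * cL n * 46 + 20) + 3) + 9 * (n * n) + 8) ∧
      (∀ i, i < 40 → S' i = S i) ∧ S' 40 = pw / 2 ∧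
      Static c n F H₀ H' ∧
      (∀ i j : Fin n, H' (F + (i * n + j)) = H (F + (i * n + j)) +
        if tval X Y (cM c n) (8 * cM c n) i j < H (F + (i * n + j)) + pw then 0 else pw) ∧
      (∀ t, t < n * n → H' (F + n * n + t) = H (F + n * n + t) ∨ H' (F + n * n + t) = pw) ∧
      bs.length ≤ cNB n * cNB n * cNB n + cL n * cL n * (n * n) ∧
      (∀ y ∈ bs, (NegativeTriangle (6 * c + 11)).size y = 3 * cL n) ∧
      (∀ y ∈ bs, ((NegativeTriangle (6 * c + 11)).encode y).length = 9 * (cL n * cL n) + 1) := by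
  have hL1 := one_le_cL n
  have hwsp : wspNT n = 2 * (n * n) + 9 * (cL n * cL n) + 3 := rfl
  have hM1 := one_le_cM c n
  have hpw2 : pw < 2 ^ w := by omega
  set nb3 := cNB n * cNB n * cNB n with hnb3
  set A := 96 * (cL n * cL n) + 25 with hA
  set Bc := cL n * cL n * (cL n * cL n * 46 + 20) + 3 with hBc
  -- `r41 := nb³`
  obtain ⟨st₁, hex₁, S₁, rfl, hS₁, h41₁⟩ : ∃ st₁, Exec w O (block [(.add, .dir 41, .dir 33, .imm 0)])
      ⟨merge S H, qs⟩ st₁ 1 ∧ ∃ S₁, st₁ = ⟨merge S₁ H, qs⟩ ∧ (∀ i, i ≠ 41 → S₁ i = S i) ∧ S₁ 41 = nb3 := by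
    refine Exec.block_of_fwd _ _ fun R hR' => ?_
    have h33 := hR.r33
    have htmp := execOps_cons_fwd hR'; clear hR'; obtain ⟨v1, hv1, hR'⟩ := htmp
    simp -failIfUnchanged (disch := omega) only [Operand.write, Operand.read, merge_apply_of_lt,
      merge_apply_of_le, Function.update_self, Function.update_of_ne, update_merge_of_lt,
      update_merge_of_le, Nat.add_zero, BinOp.eval_add_of_lt, h33] at hv1 hR'
    simp only [execOps_nil] at hR'; subst hR'; subst hv1
    exact ⟨_, rfl, fun i hi => by simp [Function.update_of_ne, hi], by simp [hnb3]⟩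
  -- the triples loop, by the potential method
  let Inv : Store → Prop := fun st => ∃ (S' H' : ℕ → ℕ) (bs : List (NegativeTriangle (6 * c + 11)).Inst),
    st = ⟨merge S' H', qs ++ bs.map (NegativeTriangle (6 * c + 11)).encode⟩ ∧
    (∀ i, i < 41 ∨ 70 < i → S' i = S₁ i) ∧ S' 41 ≤ nb3 ∧
    Static c n F H₀ H' ∧
    (∀ t, t < n * n → H' (F + t) = H (F + t)) ∧
    (∀ t, t < n * n → H' (F + n * n + t) = H (F + n * n + t) ∨ H' (F + n * n + t) = pw) ∧
    (∀ i j : Fin n, H' (F + n * n + (i * n + j)) = pw →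
      tval X Y (cM c n) (8 * cM c n) i j < H' (F + (i * n + j)) + pw) ∧
    (∀ t', S' 41 ≤ t' → t' < nb3 → ∀ iu iv, iu < cL n → iv < cL n →
      ¬ (qd X Y H' c F pw (t' / (cNB n * cNB n)) (t' / cNB n % cNB n) (t' % cNB n)).PairWit iu iv) ∧
    bs.length ≤ (nb3 - S' 41) + cL n * cL n * marks H' n F pw ∧
    (∀ y ∈ bs, (NegativeTriangle (6 * c + 11)).size y = 3 * cL n) ∧
    (∀ y ∈ bs, ((NegativeTriangle (6 * c + 11)).encode y).length = 9 * (cL n * cL n) + 1)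
  let Φ : Store → ℕ := fun st => st.mem 41 * (A + 2) + (n * n - marks st.mem n F pw) * Bc
  have hmarks0 : marks H n F pw = 0 := by
    unfold marks
    rw [Finset.card_eq_zero, Finset.filter_eq_empty_iff]
    intro t ht; exact hfd t (Finset.mem_range.1 ht)
  have h0 : Inv ⟨merge S₁ H, qs⟩ :=
    ⟨S₁, H, [], by simp, fun i _ => rfl, by rw [h41₁], hst, fun _ _ => rfl, fun _ _ => Or.inl rfl,
      fun i j hf => absurd hf (hfd _ (NegTriToAPSP.mul_add_lt_mul i.isLt j.isLt)), fun t' h1 h2 => by rw [h41₁] at h1; omega,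
      by simp, by simp, by simp⟩
  have hmarks_merge : ∀ (S' H' : ℕ → ℕ), marks (merge S' H') n F pw = marks H' n F pw := fun S' H' => by
    unfold marks; congr 1
    exact Finset.filter_congr fun t _ => by rw [merge_apply_of_le (by omega)]
  have hbody : ∀ st, Inv st → (Operand.dir 41).read st.mem ≠ 0 →
      ∃ st' t, Exec w O tripleBody st st' t ∧ Inv st' ∧ t + 2 + Φ st' ≤ Φ st := by
    rintro st ⟨S', H', bs, rfl, hS', h41le, hst', hlo', hmono', hsound', hnw', hlen', hsz', hel'⟩ hne
    change merge S' H' 41 ≠ 0 at hne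
    rw [merge_apply_of_lt (by norm_num)] at hne
    obtain ⟨tr, htr⟩ : ∃ tr, S' 41 = tr + 1 := ⟨S' 41 - 1, by omega⟩
    have htr3 : tr < nb3 := by omega
    have hR' : Regs c n F pX S' := hR.of_agree fun i hi => (hS' i (Or.inl (by omega))).trans (hS₁ i (by omega))
    obtain ⟨S'', H'', bs', t, hex, hS'', h41'', hst'', hlo'', hmono'', hsound'', hnowit, hcase, hsz'', hel''⟩ :=
      triple_spec (O := O) (qs := qs ++ bs.map (NegativeTriangle (6 * c + 11)).encode) hR'
        ((hS' 40 (by omega)).trans ((hS₁ 40 (by omega)).trans h40)) htr htr3 hn hF hpX hYF hst' hX₀ hY₀ hXM hYM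
        hpw1 hpw4 (fun t ht => by rw [hlo' t ht]; exact hlo t ht) hsound' hO hcapB hcapN hcapW hcapNB
    have hmle := marks_le H'' n F pw
    have hmono2 : marks H' n F pw ≤ marks H'' n F pw := marks_mono hmono''
    refine ⟨⟨merge S'' H'', qs ++ (bs ++ bs').map (NegativeTriangle (6 * c + 11)).encode⟩, t,
      by simpa [List.map_append, List.append_assoc] using hex,
      ⟨S'', H'', bs ++ bs', rfl, fun i hi => (hS'' i hi).trans (hS' i hi), by omega, hst'',
        fun t ht => (hlo'' t ht).trans (hlo' t ht), fun t ht => ?_, hsound'', fun t' h1 h2 iu iv hiu hiv hp => ?_,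
        ?_, ?_, ?_⟩, ?_⟩
    · rcases hmono'' t ht with h | h
      · rw [h]; exact hmono' t ht
      · exact Or.inr h
    · rcases Nat.lt_or_ge t' (tr + 1) with hlt | hge
      · have : t' = tr := by rw [h41''] at h1; omega
        subst this
        exact hnowit iu iv hiu hiv hp
      · have hp' := pairWit_anti (M := cM c n) (X := X) (Y := Y) (L := cL n)
          (bi := t' / (cNB n * cNB n)) (bj := t' / cNB n % cNB n) (bk := t' % cNB n)
          (lo := fun t => H' (F + t)) (fd := fun t => H' (F + n * n + t))
          (lo' := fun t => H'' (F + t)) (fd' := fun t => H'' (F + n * n + t))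
          (fun t ht => hlo'' t ht) (fun t ht => hmono'' t ht) hp
        exact hnw' t' (by rw [htr]; exact hge) h2 iu iv hiu hiv hp'
    · rw [h41'', List.length_append]
      rcases hcase with ⟨-, hl⟩ | ⟨-, hl, hm⟩
      · rw [hl]
        have : cL n * cL n * marks H' n F pw ≤ cL n * cL n * marks H'' n F pw := Nat.mul_le_mul_left _ hmono2
        omega
      · rw [hl]
        have : cL n * cL n * (marks H' n F pw + 1) ≤ cL n * cL n * marks H'' n F pw := Nat.mul_le_mul_left _ hm
        rw [Nat.mul_succ] at this
        omega
    · intro y hy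
      rcases List.mem_append.1 hy with h | h
      · exact hsz' y h
      · exact hsz'' y h
    · intro y hy
      rcases List.mem_append.1 hy with h | h
      · exact hel' y h
      · exact hel'' y h
    · -- the potential
      show t + 2 + (merge S'' H'' 41 * (A + 2) + (n * n - marks (merge S'' H'') n F pw) * Bc) ≤
        merge S' H' 41 * (A + 2) + (n * n - marks (merge S' H') n F pw) * Bc
      rw [merge_apply_of_lt (by norm_num), merge_apply_of_lt (by norm_num), hmarks_merge, hmarks_merge, h41'', htr]
      refine potential_step hmle ?_
      rcases hcase with ⟨ht, -⟩ | ⟨ht, -, hm⟩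
      · exact Or.inl ⟨ht, hmono2⟩
      · exact Or.inr ⟨ht, hm⟩
  obtain ⟨st₂, hexL, ⟨S₂, H₂, bs, rfl, hS₂, -, hst₂, hlo₂, hmono₂, hsound₂, hnw₂, hlen₂, hsz₂, hel₂⟩, hz⟩ :=
    ExecLE.whilenz_potential (w := w) (O := O) (x := .dir 41) (s := tripleBody) Inv Φ hbody h0
  change merge S₂ H₂ 41 = 0 at hz
  rw [merge_apply_of_lt (by norm_num)] at hz
  have hΦ0 : Φ ⟨merge S₁ H, qs⟩ ≤ nb3 * (A + 2) + n * n * Bc := by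
    show merge S₁ H 41 * (A + 2) + (n * n - marks (merge S₁ H) n F pw) * Bc ≤ _
    rw [merge_apply_of_lt (by norm_num), h41₁]
    exact Nat.add_le_add_left (Nat.mul_le_mul_right _ (Nat.sub_le _ _)) _
  -- completeness of the round: every pair below its threshold has been marked
  have hR₂ : Regs c n F pX S₂ := hR.of_agree fun i hi => (hS₂ i (Or.inl (by omega))).trans (hS₁ i (by omega))
  have hfound : ∀ i j : Fin n, tval X Y (cM c n) (8 * cM c n) i j < H₂ (F + (i * n + j)) + pw →
      H₂ (F + n * n + (i * n + j)) = pw := by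
    intro i j ht
    have hidx : (i : ℕ) * n + j < n * n := NegTriToAPSP.mul_add_lt_mul i.isLt j.isLt
    refine found_of_tval_lt (X := X) (Y := Y) (M := cM c n) (P := 8 * cM c n) (L := cL n)
      (lo := fun t => H₂ (F + t)) (fd := fun t => H₂ (F + n * n + t)) (pw := pw) hXM hYM hL1
      (fun bi bj bk hbi hbj hbk => ?_) (by
        rw [hlo₂ _ hidx]; have := hlo _ hidx; omega) ht
    change bi < cNB n at hbi; change bj < cNB n at hbj; change bk < cNB n at hbk
    obtain ⟨hlt, h1, h2, h3⟩ := triple_decode hbi hbj hbk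
    intro iu iv hiu hiv
    have := hnw₂ _ (by rw [hz]; exact Nat.zero_le _) hlt iu iv hiu hiv
    rw [h1, h2, h3] at this
    exact this
  -- the update of the lower bounds
  obtain ⟨S₃, H₃, hexU, hS₃, hlo₃, hnw₃⟩ := loUpd_spec (O := O) (S := S₂) (H := H₂)
    (qs := qs ++ bs.map (NegativeTriangle (6 * c + 11)).encode) (B := 8 * cM c n) hR₂.r9 hR₂.r30 hR₂.r35
    ((hS₂ 40 (by omega)).trans ((hS₁ 40 (by omega)).trans h40)) hF hpw2
    (fun t ht => by rw [hlo₂ t ht]; exact (hlo t ht).le) (by omega)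
    (fun t ht => by have := hst₂.fd_le t ht; omega) (by omega)
  have hR₃ : Regs c n F pX S₃ := hR₂.of_agree fun i hi => hS₃ i (by omega) (by omega) (by omega) (by omega)
  -- `pw := pw / 2`
  have h40₃ : S₃ 40 = pw := by
    rw [hS₃ 40 (by omega) (by omega) (by omega) (by omega), hS₂ 40 (by omega), hS₁ 40 (by omega), h40]
  obtain ⟨st₄, hex₄, S₄, rfl, hS₄, h40₄⟩ : ∃ st₄, Exec w O (block [(.div, .dir 40, .dir 40, .imm 2)])
      ⟨merge S₃ H₃, qs ++ bs.map (NegativeTriangle (6 * c + 11)).encode⟩ st₄ 1 ∧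
      ∃ S₄, st₄ = ⟨merge S₄ H₃, qs ++ bs.map (NegativeTriangle (6 * c + 11)).encode⟩ ∧
        (∀ i, i ≠ 40 → S₄ i = S₃ i) ∧ S₄ 40 = pw / 2 := by
    refine Exec.block_of_fwd _ _ fun R hR' => ?_
    have htmp := execOps_cons_fwd hR'; clear hR'; obtain ⟨v1, hv1, hR'⟩ := htmp
    simp -failIfUnchanged (disch := omega) only [Operand.write, Operand.read, merge_apply_of_lt,
      merge_apply_of_le, Function.update_self, Function.update_of_ne, update_merge_of_lt,
      update_merge_of_le, Nat.add_zero, BinOp.eval_div, h40₃] at hv1 hR'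
    simp only [execOps_nil] at hR'; subst hR'; subst hv1
    exact ⟨_, rfl, fun i hi => by simp [Function.update_of_ne, hi], by simp⟩
  -- assemble
  refine ⟨S₄, H₃, bs, ?_, fun i hi => ?_, h40₄, ?_, fun i j => ?_, fun t ht => ?_, ?_, hsz₂, hel₂⟩
  · have := hex₁.execLE.seqs_cons (hexL.seqs_cons (hexU.seqs_cons (ExecLE.seqs_one hex₄.execLE)))
    unfold roundBody
    refine this.mono ?_
    have : Φ ⟨merge S₁ H, qs⟩ + 1 ≤ nb3 * (A + 2) + n * n * Bc + 1 := by omega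
    rw [hA, hBc] at this
    nlinarith [this]
  · rw [hS₄ i (by omega), hS₃ i (by omega) (by omega) (by omega) (by omega), hS₂ i (by omega), hS₁ i (by omega)]
  · exact
      { below := fun a ha => by rw [hnw₃ a (Or.inl ha)]; exact hst₂.below a ha
        hdr := by rw [hnw₃ _ (Or.inr (by omega))]; exact hst₂.hdr
        bg := fun u v hu hv h1 h2 h3 => by
          have := qcell_bounds (F := F) (n := n) hu hv
          rw [hnw₃ _ (Or.inr (by omega))]; exact hst₂.bg u v hu hv h1 h2 h3
        above := fun a ha => by rw [hnw₃ a (Or.inr (by omega))]; exact hst₂.above a ha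
        fd_le := fun t ht => by rw [hnw₃ _ (Or.inr (by omega))]; exact hst₂.fd_le t ht }
  · have hidx : (i : ℕ) * n + j < n * n := NegTriToAPSP.mul_add_lt_mul i.isLt j.isLt
    rw [hlo₃ _ hidx, hlo₂ _ hidx]
    congr 1
    by_cases ht : tval X Y (cM c n) (8 * cM c n) i j < H (F + (i * n + j)) + pw
    · rw [if_pos ht, if_pos (hfound i j (by rw [hlo₂ _ hidx]; exact ht))]
    · rw [if_neg ht, if_neg]
      intro hf
      have := hsound₂ i j hf
      rw [hlo₂ _ hidx] at this
      exact ht this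
  · rw [hnw₃ _ (Or.inr (by omega))]; exact hmono₂ t ht
  · have := marks_le H₂ n F pw
    have : cL n * cL n * marks H₂ n F pw ≤ cL n * cL n * (n * n) := Nat.mul_le_mul_left _ this
    omega

end Literature.Computability.FineGrained.NegTriSweep

namespace Literature.Computability.FineGrained.NegTriSweep

open Cryptography Cryptography.WordRAM Cryptography.WordRAM.SProg APSPPower Matrix NegTriStep

set_option linter.unusedSimpArgs false

/-! ## All rounds of the search -/

/-- `2^(k+1) / 2 = 2^k` and `2^0 / 2 = 0`: the bit after `i` of `K + 1` rounds. [folklore] -/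
theorem pow_sub_div_two {K i : ℕ} (hi : i ≤ K) : 2 ^ (K + 1 - i) / 2 = 2 ^ (K - i) := by
  rw [show K + 1 - i = (K - i) + 1 by omega, pow_succ, Nat.mul_div_cancel _ (by norm_num)]

/-- The time of one round (see `round_spec`). [folklore] -/
theorem round_time_def (n : ℕ) : cNB n * cNB n * cNB n * (96 * (cL n * cL n) + 27) +
    n * n * (cL n * cL n * (cL n * cL n * 46 + 20) + 3) + 9 * (n * n) + 8 =
    cNB n * cNB n * cNB n * (96 * (cL n * cL n) + 27) +
    n * n * (cL n * cL n * (cL n * cL n * 46 + 20) + 3) + 9 * (n * n) + 8 := rfl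

open Classical in
/-- **The rounds of the simultaneous binary search** (`whilenz (r40) roundBody`, VW–W proof of
Thm. 4.2: "We continue iterating until … Hence the number of iterations is `O(log W)`"): started
with `pw = 4M = 2^K`, `lo = 0` and no stamps, after `K + 1 = cR c n` rounds every lower bound
equals the searched value `tval` of its pair (the dyadic invariant `lo = ⌊tval / 2pw⌋ · 2pw`,
`lo_step`), with at most `cR c n · (nb³ + L² n²)` queries of size `3L`. [folklore] -/
theorem rounds_spec {w c n F pX : ℕ} {O : List ℕ → List ℕ}
    {X Y : Matrix (Fin n) (Fin n) (WithTop ℤ)} {H₀ S H : ℕ → ℕ} {qs : List (List ℕ)}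
    (hR : Regs c n F pX S) (h40 : S 40 = 4 * cM c n)
    (hn : 1 ≤ n) (hF : 100 ≤ F) (hpX : 100 ≤ pX) (hYF : pX + n * n + 1 + n * n < F)
    (hst : Static c n F H₀ H) (hX₀ : MatAt H₀ pX X) (hY₀ : MatAt H₀ (pX + n * n + 1) Y)
    (hXM : HasBoundedWeights X (cM c n)) (hYM : HasBoundedWeights Y (cM c n))
    (hlo0 : ∀ t, t < n * n → H (F + t) = 0) (hfd0 : ∀ t, t < n * n → H (F + n * n + t) = 0)
    (hO : (NegativeTriangle (6 * c + 11)).OracleAnswers O)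
    (hcapB : 2 * (32 * cM c n + 9) < 2 ^ w) (hcapN : (n + cL n) * n + (n + cL n) < 2 ^ w)
    (hcapW : F + wspNT n < 2 ^ w) (hcapNB : cNB n * cNB n * cNB n < 2 ^ w) :
    ∃ (S' H' : ℕ → ℕ) (bs : List (NegativeTriangle (6 * c + 11)).Inst),
      ExecLE w O (whilenz (.dir 40) roundBody) ⟨merge S H, qs⟩
        ⟨merge S' H', qs ++ bs.map (NegativeTriangle (6 * c + 11)).encode⟩
        (cR c n * (cNB n * cNB n * cNB n * (96 * (cL n * cL n) + 27) +
          n * n * (cL n * cL n * (cL n * cL n * 46 + 20) + 3) + 9 * (n * n) + 8 + 2) + 1) ∧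
      (∀ i, i < 40 → S' i = S i) ∧
      Static c n F H₀ H' ∧
      (∀ i j : Fin n, H' (F + (i * n + j)) = tval X Y (cM c n) (8 * cM c n) i j) ∧
      bs.length ≤ cR c n * (cNB n * cNB n * cNB n + cL n * cL n * (n * n)) ∧
      (∀ y ∈ bs, (NegativeTriangle (6 * c + 11)).size y = 3 * cL n) ∧
      (∀ y ∈ bs, ((NegativeTriangle (6 * c + 11)).encode y).length = 9 * (cL n * cL n) + 1) := by
  have hM1 := one_le_cM c n
  set K := (c + 1) * Nat.size n + 2 with hK
  have h4M : 4 * cM c n = 2 ^ K := by rw [hK, pow_add]; unfold cM; ring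
  have h8M : 8 * cM c n = 2 ^ (K + 1) := by rw [pow_succ, ← h4M]; ring
  have hR' : cR c n = K + 1 := by rw [hK]; unfold cR; ring
  have hP : 4 * cM c n + 2 ≤ 8 * cM c n := by omega
  set Tr := cNB n * cNB n * cNB n * (96 * (cL n * cL n) + 27) +
    n * n * (cL n * cL n * (cL n * cL n * 46 + 20) + 3) + 9 * (n * n) + 8 with hTr
  set Qr := cNB n * cNB n * cNB n + cL n * cL n * (n * n) with hQr
  -- the invariant after `i` rounds
  let Inv : ℕ → Store → Prop := fun i st => ∃ (S' H' : ℕ → ℕ) (bs : List (NegativeTriangle (6 * c + 11)).Inst),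
    st = ⟨merge S' H', qs ++ bs.map (NegativeTriangle (6 * c + 11)).encode⟩ ∧
    (∀ j, j < 40 → S' j = S j) ∧ S' 40 = 2 ^ (K + 1 - i) / 2 ∧
    Static c n F H₀ H' ∧
    (∀ i' j' : Fin n, H' (F + (i' * n + j')) =
      tval X Y (cM c n) (8 * cM c n) i' j' / 2 ^ (K + 1 - i) * 2 ^ (K + 1 - i)) ∧
    (∀ t, t < n * n → H' (F + n * n + t) = 0 ∨ 2 ^ (K + 1 - i) / 2 < H' (F + n * n + t)) ∧
    bs.length ≤ i * Qr ∧
    (∀ y ∈ bs, (NegativeTriangle (6 * c + 11)).size y = 3 * cL n) ∧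
    (∀ y ∈ bs, ((NegativeTriangle (6 * c + 11)).encode y).length = 9 * (cL n * cL n) + 1)
  have h0 : Inv 0 ⟨merge S H, qs⟩ := by
    refine ⟨S, H, [], by simp, fun j _ => rfl, by rw [h40, h4M, Nat.sub_zero, show 2 ^ (K + 1) = 2 ^ K * 2 from pow_succ 2 K, Nat.mul_div_cancel _ (by norm_num)],
      hst, fun i' j' => ?_, fun t ht => Or.inl (hfd0 t ht), by simp, by simp, by simp⟩
    rw [hlo0 _ (NegTriToAPSP.mul_add_lt_mul i'.isLt j'.isLt), Nat.sub_zero, ← h8M,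
      Nat.div_eq_of_lt (tval_lt hXM hYM hP i' j'), Nat.zero_mul]
  have hbody : ∀ i, i < K + 1 → ∀ st, Inv i st → (Operand.dir 40).read st.mem ≠ 0 ∧
      ∃ st', ExecLE w O roundBody st st' Tr ∧ Inv (i + 1) st' := by
    rintro i hi st ⟨S', H', bs, rfl, hS', h40', hst', hlo', hfd', hlen', hsz', hel'⟩
    have hpw : 2 ^ (K + 1 - i) / 2 = 2 ^ (K - i) := pow_sub_div_two (by omega)
    have h2pw : 2 ^ (K + 1 - i) = 2 * 2 ^ (K - i) := by rw [show K + 1 - i = (K - i) + 1 by omega, pow_succ]; ring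
    rw [hpw] at h40' hfd'
    have hpw1 : 1 ≤ 2 ^ (K - i) := Nat.one_le_two_pow
    have hpw4 : 2 ^ (K - i) ≤ 4 * cM c n := by rw [h4M]; exact Nat.pow_le_pow_right (by norm_num) (by omega)
    have hdvd : 2 * 2 ^ (K - i) ∣ 8 * cM c n := by
      rw [h8M, ← pow_succ']; exact Nat.pow_dvd_pow 2 (by omega)
    refine ⟨by change merge S' H' 40 ≠ 0; rw [merge_apply_of_lt (by norm_num), h40']; omega, ?_⟩
    have hR'' : Regs c n F pX S' := hR.of_agree hS'
    have hloT : ∀ t, t < n * n → H' (F + t) + 2 ^ (K - i) < 8 * cM c n := by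
      intro t ht
      have hi' : t / n < n := Nat.div_lt_of_lt_mul (by rwa [Nat.mul_comm] at ht)
      have hj' : t % n < n := Nat.mod_lt _ (by omega)
      have := hlo' ⟨t / n, hi'⟩ ⟨t % n, hj'⟩
      simp only at this
      rw [Nat.div_add_mod' t n, h2pw] at this
      rw [this]
      exact lo_add_pw_lt (tval_lt hXM hYM hP _ _) hdvd hpw1
    obtain ⟨S'', H'', bs', hex, hS'', h40'', hst'', hlo'', hfd'', hlen'', hsz'', hel''⟩ :=
      round_spec (O := O) (qs := qs ++ bs.map (NegativeTriangle (6 * c + 11)).encode) hR'' h40' hn hF hpX hYF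
        hst' hX₀ hY₀ hXM hYM hpw1 hpw4 hloT
        (fun t ht h => by rcases hfd' t ht with h' | h' <;> omega) hO hcapB hcapN hcapW hcapNB
    refine ⟨⟨merge S'' H'', qs ++ (bs ++ bs').map (NegativeTriangle (6 * c + 11)).encode⟩,
      by simpa [List.map_append, List.append_assoc] using hex,
      S'', H'', bs ++ bs', rfl, fun j hj => (hS'' j hj).trans (hS' j hj), ?_, hst'', fun i' j' => ?_,
      fun t ht => ?_, ?_, ?_, ?_⟩
    · rw [h40'', show K + 1 - (i + 1) = K - i by omega]
    · have hidx : (i' : ℕ) * n + j' < n * n := NegTriToAPSP.mul_add_lt_mul i'.isLt j'.isLt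
      rw [hlo'' i' j', hlo' i' j', show K + 1 - (i + 1) = K - i by omega, h2pw]
      exact lo_step hpw1 rfl
    · rw [show K + 1 - (i + 1) = K - i by omega]
      rcases hfd'' t ht with h | h
      · rw [h]
        rcases hfd' t ht with h' | h'
        · exact Or.inl h'
        · right; have := Nat.div_le_self (2 ^ (K - i)) 2; omega
      · right; rw [h]; exact Nat.div_lt_self hpw1 (by norm_num)
    · simp only [List.length_append, Nat.succ_mul]; omega
    · intro y hy
      rcases List.mem_append.1 hy with h | h
      · exact hsz' y h
      · exact hsz'' y h
    · intro y hy
      rcases List.mem_append.1 hy with h | h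
      · exact hel' y h
      · exact hel'' y h
  have hexit : ∀ st, Inv (K + 1) st → (Operand.dir 40).read st.mem = 0 := by
    rintro st ⟨S', H', bs, rfl, -, h40', -⟩
    change merge S' H' 40 = 0
    rw [merge_apply_of_lt (by norm_num), h40', Nat.sub_self, pow_zero]
    norm_num
  obtain ⟨st', hexL, S', H', bs, rfl, hS', -, hst', hlo', -, hlen', hsz', hel'⟩ :=
    ExecLE.whilenz_invariant (w := w) (O := O) (x := .dir 40) (s := roundBody) (K + 1) Tr Inv hbody hexit h0
  refine ⟨S', H', bs, by rw [hR']; exact hexL, hS', hst', fun i j => ?_, by rw [hR']; exact hlen', hsz', hel'⟩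
  rw [hlo' i j, Nat.sub_self, pow_zero, Nat.div_one, Nat.mul_one]

end Literature.Computability.FineGrained.NegTriSweep
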